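import Summits.HodgeConjecture.CorCM.Census.QuarticInversionDescent

/-!
# The quartic inversion twists, VII: the pair-odd product functionals — they kill the pairs and every half-preserving face

COR-CM (cell `pub-hodgecm2`, stage 2 of the Hodge ladder), count-neutral KERNEL COMBINATORICS by the binder seat b23 (gen 44; claim
QUARTIC-INVERSION, HOME/INBOX.md l.12829).  Part VII of the lane `Census/QuarticInversion*`, on top of parts I–VI, all BY NAME.  Bookkeeping
definitions with bodies (`fnl`, `sq`, `wUp`, `wMatch`, `wA`, `wC`) + theorems; no `Prop`-valued definition, no `decide` table, no certificate, no named
fact, no geometry, no `sorry`.  `Interfaces.lean` (C1), every E term, B01, `Transposition/*`, `PortJoin/*` untouched.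
HONEST FRAMING: `HC_CM` is NOT proved, here or anywhere in the tree; nothing here is a period, a count of record or a headline.

CONTENT (the analogue, for four coordinates, of the functionals `U_s, U′_s, C₀, C₁` of the dicyclic lane).
* §1 For a weight `w : Ty₄ B → ℤ`, **the pair-odd functional** `fnl w : ℤ[Ty₄ B] → ℤ`, `v ↦ Σ_Θ v(Θ)·(w Θ − w Θ̄)`: it kills every pair
  (`fnl_pairVec₄`, `fnl_eq_zero_of_mem_pairs₄`), and on a face `fnl w (faceVec₄ Θ p q) = sq w Θ p q − sq w Θ̄ p q` with the SIGNED SQUARE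
  `sq w Θ p q = w Θ − w Θ^{(p)} − w Θ^{(q)} + w Θ^{(pq)}` (`fnl_faceVec₄`).
* §2 **The weights**: `wUp j s Θ = [coord j Θ is UP and has bit s equal to 0]`, `wMatch j η Θ = [the halves of the coordinates i ≠ j are η i]`,
  `wA j η s = wMatch j η · wUp j s` (the ATOM functionals: one bit-reader in coordinate `j`, half-indicators elsewhere) and `wC η = [all four halves are η]`
  (the CONSTANT functionals).  Their signed squares vanish at every pair of distinct places whose three flipped corners keep every coordinate in its
  half (`sq_wA_eq_zero`, `sq_wC_eq_zero`: a product of functions each affine along the square, at most one of them non-constant), hence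
  (§3, `|B|` odd, so that conjugation flips every half) **`fnl (wA j η s)` and `fnl (wC η)` vanish on every half-preserving face** — in particular on the
  reducing faces of part VI (`fnl_wA_faceVec₄_eq_zero`, `fnl_wC_faceVec₄_eq_zero`) and on all their translates.
Part VIII reads these functionals on residual vectors (key lemma); the closing faces of the lane are exactly faces which CROSS the equator in one
coordinate, where these functionals do not vanish.  All [folklore].

## References
* [Pohlmann1968] H. Pohlmann, Algebraic cycles on abelian varieties of complex multiplication type, Ann. of Math. 88 (1968), Thm 1.
-/

namespace Summit.HodgeConjecture.CorCM.Census.QuarticInversion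

open Finset
open Summit.HodgeConjecture.CorCM.Census.OddSliceFacesModel
open Summit.HodgeConjecture.CorCM.Census.DicyclicTwist (Ty₂)

noncomputable section

variable (A : Type) [AddCommGroup A] [Fintype A] [DecidableEq A]

/-! ## §1 Pair-odd functionals and their values on pairs and faces -/

/-- **The pair-odd functional with weight `w`**: `v ↦ Σ_Θ v(Θ)·(w Θ − w Θ̄)`. [folklore] -/
def fnl (w : Ty₄ A → ℤ) : (Ty₄ A → ℤ) →ₗ[ℤ] ℤ where
  toFun v := ∑ Θ, v Θ * (w Θ - w (conj₄ A Θ))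
  map_add' v v' := by simp only [Pi.add_apply, add_mul, Finset.sum_add_distrib]
  map_smul' n v := by simp only [Pi.smul_apply, smul_eq_mul, mul_assoc, Finset.mul_sum, RingHom.id_apply]

omit [AddCommGroup A] in
/-- Value on a unit vector. [folklore] -/
@[simp] theorem fnl_single (w : Ty₄ A → ℤ) (Θ : Ty₄ A) (n : ℤ) : fnl A w (Pi.single Θ n) = n * (w Θ - w (conj₄ A Θ)) := by
  show ∑ Φ, (Pi.single Θ n : Ty₄ A → ℤ) Φ * (w Φ - w (conj₄ A Φ)) = _
  rw [Finset.sum_eq_single Θ]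
  · rw [Pi.single_eq_same]
  · intro Φ _ hne; rw [Pi.single_eq_of_ne hne, zero_mul]
  · intro h; exact absurd (Finset.mem_univ Θ) h

omit [Fintype A] [DecidableEq A] [AddCommGroup A] in
/-- Conjugation is an involution on quadruples. [folklore] -/
@[simp] theorem conj₄_conj₄ (Θ : Ty₄ A) : conj₄ A (conj₄ A Θ) = Θ := by
  refine ext_coord A fun k => ?_
  rw [coord_conj₄, coord_conj₄, add_one_add_one]

omit [AddCommGroup A] in
/-- **Pair-odd functionals kill the pairs.** [folklore] -/
theorem fnl_pairVec₄ [AddCommGroup A] (w : Ty₄ A → ℤ) (Θ : Ty₄ A) : fnl A w (pairVec₄ A Θ) = 0 := by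
  rw [pairVec₄, map_add, fnl_single, fnl_single, conj₄_conj₄]
  ring

/-- Pair-odd functionals vanish on `pairs₄`. [folklore] -/
theorem fnl_eq_zero_of_mem_pairs₄ (w : Ty₄ A → ℤ) {v : Ty₄ A → ℤ} (hv : v ∈ pairs₄ A) : fnl A w v = 0 := by
  refine Submodule.span_induction (p := fun u _ => fnl A w u = 0) ?_ ?_ ?_ ?_ hv
  · rintro _ ⟨Θ, rfl⟩; exact fnl_pairVec₄ A w Θ
  · exact map_zero _
  · intro x y _ _ hx hy; rw [map_add, hx, hy, add_zero]
  · intro n x _ hx; rw [map_smul, hx, smul_zero]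

/-- **The signed square** of a weight at `Θ, p, q`: `w Θ − w Θ^{(p)} − w Θ^{(q)} + w Θ^{(pq)}`. [folklore] -/
def sq (w : Ty₄ A → ℤ) (Θ : Ty₄ A) (p q : Pl A) : ℤ :=
  w Θ - w (flipAt A p Θ) - w (flipAt A q Θ) + w (flipAt A p (flipAt A q Θ))

omit [Fintype A] [AddCommGroup A] in
/-- Conjugation commutes with flips. [folklore] -/
theorem conj₄_flipAt (p : Pl A) (Θ : Ty₄ A) : conj₄ A (flipAt A p Θ) = flipAt A p (conj₄ A Θ) := conj₄_addAt A p.1 _ Θ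

omit [AddCommGroup A] in
/-- **Value of a pair-odd functional on a face**: the signed square at `Θ` minus the signed square at `Θ̄`. [folklore] -/
theorem fnl_faceVec₄ (w : Ty₄ A → ℤ) (Θ : Ty₄ A) (p q : Pl A) :
    fnl A w (faceVec₄ A Θ p q) = sq A w Θ p q - sq A w (conj₄ A Θ) p q := by
  rw [faceVec₄, map_add, map_add, map_add, fnl_single, fnl_single, fnl_single, fnl_single, sq, sq]
  simp only [conj₄_flipAt, conj₄_conj₄]
  ring

/-! ## §2 The atom weights and the constant weights; their signed squares vanish on half-preserving squares -/

/-- `[coord j Θ is up and has bit s = 0]`. [folklore] -/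
def wUp (j : Fin 4) (s : A) (Θ : Ty₄ A) : ℤ := if half A (coord A j Θ) = false ∧ coord A j Θ s = 0 then 1 else 0

/-- `[the halves of the coordinates other than j follow η]`. [folklore] -/
def wMatch (j : Fin 4) (η : Fin 4 → Bool) (Θ : Ty₄ A) : ℤ := if ∀ i, i ≠ j → half A (coord A i Θ) = η i then 1 else 0

/-- **The atom weight** `wA j η s = wMatch j η · wUp j s`. [folklore] -/
def wA (j : Fin 4) (η : Fin 4 → Bool) (s : A) (Θ : Ty₄ A) : ℤ := wMatch A j η Θ * wUp A j s Θ

/-- **The constant weight** `wC η = [all four halves follow η]`. [folklore] -/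
def wC (η : Fin 4 → Bool) (Θ : Ty₄ A) : ℤ := if ∀ i, half A (coord A i Θ) = η i then 1 else 0

omit [AddCommGroup A] [DecidableEq A] in
/-- Along a half-preserving square, `wMatch` is constant. [folklore] -/
theorem wMatch_eq_of_halves (j : Fin 4) (η : Fin 4 → Bool) {Θ Θ' : Ty₄ A} (h : ∀ n, half A (coord A n Θ') = half A (coord A n Θ)) :
    wMatch A j η Θ' = wMatch A j η Θ := by
  unfold wMatch
  simp only [h]

omit [AddCommGroup A] [DecidableEq A] in
/-- Along a half-preserving square, `wC` is constant. [folklore] -/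
theorem wC_eq_of_halves (η : Fin 4 → Bool) {Θ Θ' : Ty₄ A} (h : ∀ n, half A (coord A n Θ') = half A (coord A n Θ)) :
    wC A η Θ' = wC A η Θ := by
  unfold wC
  simp only [h]

/-- The bit read by `wUp` along the square: `[x = 0] − [x + a = 0] − [x + b = 0] + [x + a + b = 0] = 0` in `ℤ/2` unless `a = b = 1`. [folklore] -/
private theorem bit_square (x a b : ZMod 2) (hab : ¬ (a = 1 ∧ b = 1)) :
    ((if x = 0 then (1 : ℤ) else 0) - (if x + a = 0 then 1 else 0) - (if x + b = 0 then 1 else 0) + (if x + a + b = 0 then 1 else 0)) = 0 := by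
  revert x a b hab; decide

omit [AddCommGroup A] [Fintype A] in
/-- The bumps of two distinct places never both read `1` at the same position of the same coordinate. [folklore] -/
theorem not_bump_and_bump (j : Fin 4) {p q : Pl A} (hpq : p ≠ q) (s : A) : ¬ (bump A j p s = 1 ∧ bump A j q s = 1) := by
  rintro ⟨hp, hq⟩
  unfold bump at hp hq
  by_cases hjp : j = p.1
  · by_cases hjq : j = q.1
    · rw [if_pos hjp, delta_apply] at hp
      rw [if_pos hjq, delta_apply] at hq
      by_cases hsp : s = p.2
      · by_cases hsq : s = q.2
        · exact hpq (Prod.ext (hjp.symm.trans hjq) (hsp.symm.trans hsq))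
        · rw [if_neg hsq] at hq; exact zero_ne_one hq
      · rw [if_neg hsp] at hp; exact zero_ne_one hp
    · rw [if_neg hjq] at hq; exact zero_ne_one hq
  · rw [if_neg hjp] at hp; exact zero_ne_one hp

omit [AddCommGroup A] in
/-- **The signed square of an atom weight vanishes on every half-preserving square at distinct places.** [folklore] -/
theorem sq_wA_eq_zero (j : Fin 4) (η : Fin 4 → Bool) (s : A) {Θ : Ty₄ A} {p q : Pl A} (hpq : p ≠ q)
    (h : ∀ c, ∀ n, half A (coord A n (corner A Θ p q c)) = half A (coord A n Θ)) : sq A (wA A j η s) Θ p q = 0 := by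
  have h0 := h 0; have h1 := h 1; have h2 := h 2
  simp only [corner_zero, corner_one, corner_two] at h0 h1 h2
  unfold sq wA
  rw [wMatch_eq_of_halves A j η h0, wMatch_eq_of_halves A j η h1, wMatch_eq_of_halves A j η h2]
  -- the bit factor
  unfold wUp
  rw [h0 j, h1 j, h2 j]
  cases hh : half A (coord A j Θ)
  · simp only [true_and, coord_flipAt, Pi.add_apply]
    have key := bit_square (coord A j Θ s) (bump A j q s) (bump A j p s) (not_bump_and_bump A j hpq.symm s)
    have gen : ∀ M b0 b1 b2 b3 : ℤ, b0 - b1 - b2 + b3 = 0 → M * b0 - M * b2 - M * b1 + M * b3 = 0 := by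
      intro M b0 b1 b2 b3 hb
      have e : M * b0 - M * b2 - M * b1 + M * b3 = M * (b0 - b1 - b2 + b3) := by ring
      rw [e, hb, mul_zero]
    exact gen _ _ _ _ _ key
  · simp

omit [AddCommGroup A] in
/-- **The signed square of a constant weight vanishes on every half-preserving square.** [folklore] -/
theorem sq_wC_eq_zero (η : Fin 4 → Bool) {Θ : Ty₄ A} {p q : Pl A}
    (h : ∀ c, ∀ n, half A (coord A n (corner A Θ p q c)) = half A (coord A n Θ)) : sq A (wC A η) Θ p q = 0 := by
  have h0 := h 0; have h1 := h 1; have h2 := h 2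
  simp only [corner_zero, corner_one, corner_two] at h0 h1 h2
  unfold sq
  rw [wC_eq_of_halves A η h0, wC_eq_of_halves A η h1, wC_eq_of_halves A η h2]
  ring

/-! ## §3 `|B|` odd: the functionals vanish on every half-preserving face -/

omit [AddCommGroup A] in
/-- For `|B|` odd, halves kept at `Θ` are kept at `Θ̄`. [folklore] -/
theorem halves_conj₄ (hA : Odd (Fintype.card A)) {Θ : Ty₄ A} {p q : Pl A}
    (h : ∀ c, ∀ n, half A (coord A n (corner A Θ p q c)) = half A (coord A n Θ)) :
    ∀ c, ∀ n, half A (coord A n (corner A (conj₄ A Θ) p q c)) = half A (coord A n (conj₄ A Θ)) := by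
  intro c n
  have hc : corner A (conj₄ A Θ) p q c = conj₄ A (corner A Θ p q c) := by
    fin_cases c <;> simp [corner, conj₄_flipAt]
  rw [hc, coord_conj₄, coord_conj₄, half_add_one_eq_iff A hA]
  exact h c n

omit [AddCommGroup A] in
/-- **`fnl (wA j η s)` vanishes on every half-preserving face** (`|B|` odd). [folklore] -/
theorem fnl_wA_faceVec₄_eq_zero (hA : Odd (Fintype.card A)) (j : Fin 4) (η : Fin 4 → Bool) (s : A) {Θ : Ty₄ A} {p q : Pl A}
    (hpq : p ≠ q) (h : ∀ c, ∀ n, half A (coord A n (corner A Θ p q c)) = half A (coord A n Θ)) :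
    fnl A (wA A j η s) (faceVec₄ A Θ p q) = 0 := by
  rw [fnl_faceVec₄, sq_wA_eq_zero A j η s hpq h, sq_wA_eq_zero A j η s hpq (halves_conj₄ A hA h), sub_zero]

omit [AddCommGroup A] in
/-- **`fnl (wC η)` vanishes on every half-preserving face** (`|B|` odd). [folklore] -/
theorem fnl_wC_faceVec₄_eq_zero (hA : Odd (Fintype.card A)) (η : Fin 4 → Bool) {Θ : Ty₄ A} {p q : Pl A}
    (h : ∀ c, ∀ n, half A (coord A n (corner A Θ p q c)) = half A (coord A n Θ)) :
    fnl A (wC A η) (faceVec₄ A Θ p q) = 0 := by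
  rw [fnl_faceVec₄, sq_wC_eq_zero A η h, sq_wC_eq_zero A η (halves_conj₄ A hA h), sub_zero]

/-- **The functionals vanish on the span of the pairs and of any family of half-preserving faces.** [folklore] -/
theorem fnl_eq_zero_of_mem_span (hA : Odd (Fintype.card A)) (w : Ty₄ A → ℤ)
    (hw : (∃ j η s, w = wA A j η s) ∨ ∃ η, w = wC A η) (S : Set (Ty₄ A → ℤ))
    (hS : ∀ v ∈ S, ∃ Θ p q, p ≠ q ∧ (∀ c, ∀ n, half A (coord A n (corner A Θ p q c)) = half A (coord A n Θ)) ∧ v = faceVec₄ A Θ p q)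
    {v : Ty₄ A → ℤ} (hv : v ∈ pairs₄ A ⊔ Submodule.span ℤ S) : fnl A w v = 0 := by
  obtain ⟨v₁, h₁, v₂, h₂, rfl⟩ := Submodule.mem_sup.mp hv
  rw [map_add, fnl_eq_zero_of_mem_pairs₄ A w h₁, zero_add]
  refine Submodule.span_induction (p := fun u _ => fnl A w u = 0) ?_ ?_ ?_ ?_ h₂
  · intro u hu
    obtain ⟨Θ, p, q, hpq, hh, rfl⟩ := hS u hu
    rcases hw with ⟨j, η, s, rfl⟩ | ⟨η, rfl⟩
    · exact fnl_wA_faceVec₄_eq_zero A hA j η s hpq hh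
    · exact fnl_wC_faceVec₄_eq_zero A hA η hh
  · exact map_zero _
  · intro x y _ _ hx hy; rw [map_add, hx, hy, add_zero]
  · intro n x _ hx; rw [map_smul, hx, smul_zero]

end

end Summit.HodgeConjecture.CorCM.Census.QuarticInversion
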